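import Mathlib

/-!
# Tier4/Common/AdelicDefs — the adelic unitary group of the plane, its rational points, tori and centre, DEFINED on
Mathlib's adele ring (Adelic v0.4, (D1) of the lead's ruling S12038; (D2) is `Tier4/Common/AdelicRTF.lean`)

Blind re-derivation cell `pub-hodge-repro`, Tier 4 (README §9–§10), seat t4-typer-2 (gen 0).  Target tree path
`lean/Summits/Ventures/HodgeRepro/Tier4/Common/AdelicDefs.lean`.  Mathlib only (the interface `Tier4/Common/Adelic.lean`
v0.3 is instantiated by these objects in `AdelicRTF.lean`, `RTFData.toAdelicPair`).

(D1) THE GROUPS, through the `k`-structure of the plane (`k = E′⁺`).  `W = E′²` is a 4-dimensional `k`-space; the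
hermitian form `h` of the plane gives the symmetric `k`-bilinear trace form with Gram matrix `B ∈ M₄(k)`, the
`E′`-structure is the matrix `Ω ∈ M₄(k)` of multiplication by a generator of `E′/k`, and the two lines of each
torus are the images of commuting projectors `P₀, P₁` (resp. `Q₀, Q₁` for the second torus, after the N1 isometry)
— the `PlaneData k`, with its defining matrix identities as fields.  The adelic points are then
  `unitaryGroup W := {g ∈ GL₄(𝔸_k) | g Ω = Ω g ∧ g B gᵀ = B}`   (`𝔸_k = NumberField.AdeleRing (𝓞 k) k`),
a subgroup of the topological group `GL (Fin 4) 𝔸_k` (Mathlib: matrices over a topological ring, the units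
topology), hence a topological group; `rationalPoints W` = the elements coming from `GL₄(k)` through
`algebraMap k 𝔸_k` (the shape of Mathlib's `AdeleRing.principalSubgroup`); `torus W i` = the elements commuting with
the two projectors of the torus `i` (`i = 0`: `T = U(W₀) × U(W₁)`, `i = 1`: `T′`); `scalars W` = the `E′`-scalars
`a • 1 + b • Ω` in the group (the centre `Z`, contained in both tori because the lines are `E′`-subspaces).

Nothing here is a theorem about the intended objects beyond the definitional identities recorded; nothing here says
anything about the status of the Hodge conjecture for CM abelian varieties, which is NOT proved (HC_CM is NOT proved
by anyone in this repository).
-/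

set_option autoImplicit false

noncomputable section

namespace Summit.Ventures.HodgeRepro.Tier4.Common

open NumberField Matrix
open scoped NumberField

/-! ## (D1) The adelic groups -/

section Groups

variable (k : Type) [Field k] [NumberField k]

/-- The adele ring `𝔸_k` of the number field `k` (Mathlib `NumberField.AdeleRing`). -/
abbrev Ad : Type := AdeleRing (𝓞 k) k

/-- `M₄(𝔸_k)`. -/
abbrev M4 : Type := Matrix (Fin 4) (Fin 4) (Ad k)

/-- `GL₄(𝔸_k)` with the units topology (a topological group). -/
abbrev GL4 : Type := GL (Fin 4) (Ad k)

/-- A `k`-matrix as an adelic matrix, entrywise through `algebraMap k 𝔸_k`. -/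
def adMat (A : Matrix (Fin 4) (Fin 4) k) : Matrix (Fin 4) (Fin 4) (Ad k) := A.map (algebraMap k (Ad k))

/-- **The rational structure of the plane** `W = E′²` as a `4`-dimensional `k`-space: the Gram matrix `B` of the
trace form of the hermitian form, the matrix `Ω` of multiplication by a generator of `E′/k`, the projectors `P i`
onto the two lines of the torus `T` (`P 0` onto `W₀`, `P 1` onto `W₁`) and `Q i` onto the two lines of `T′`, with the
defining identities: `B` symmetric, `Ω` commuting with every projector (the lines are `E′`-subspaces), the
projectors of a torus idempotent, complementary and orthogonal. -/
structure PlaneData where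
  /-- the Gram matrix of the `k`-bilinear trace form `Tr_{E′/k} h(x, y)` -/
  B : Matrix (Fin 4) (Fin 4) k
  /-- the matrix of multiplication by a generator of `E′` over `k` -/
  Ω : Matrix (Fin 4) (Fin 4) k
  /-- the projectors onto the lines `W₀`, `W₁` of `T` -/
  P : Fin 2 → Matrix (Fin 4) (Fin 4) k
  /-- the projectors onto the lines `g W₂`, `g W₃` of `T′` -/
  Q : Fin 2 → Matrix (Fin 4) (Fin 4) k
  /-- `B` is symmetric -/
  B_symm : Bᵀ = B
  /-- the lines are `E′`-subspaces -/
  P_comm : ∀ i, P i * Ω = Ω * P i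
  /-- the lines of `T′` are `E′`-subspaces -/
  Q_comm : ∀ i, Q i * Ω = Ω * Q i
  /-- the projectors of `T` are idempotent -/
  P_idem : ∀ i, P i * P i = P i
  /-- the projectors of `T′` are idempotent -/
  Q_idem : ∀ i, Q i * Q i = Q i
  /-- `W = W₀ ⊕ W₁` -/
  P_sum : P 0 + P 1 = 1
  /-- `W = g W₂ ⊕ g W₃` -/
  Q_sum : Q 0 + Q 1 = 1

variable {k} (W : PlaneData k)

/-- `adMat` is a ring homomorphism's action: products go to products. -/
theorem adMat_mul (A A' : Matrix (Fin 4) (Fin 4) k) : adMat k (A * A') = adMat k A * adMat k A' :=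
  Matrix.map_mul

/-- `adMat` of the identity. -/
theorem adMat_one : adMat k (1 : Matrix (Fin 4) (Fin 4) k) = 1 :=
  Matrix.map_one _ (map_zero _) (map_one _)

/-- `adMat` of a sum. -/
theorem adMat_add (A A' : Matrix (Fin 4) (Fin 4) k) : adMat k (A + A') = adMat k A + adMat k A' :=
  Matrix.map_add _ (map_add _) _ _

/-- `adMat` commutes with transposition. -/
theorem adMat_transpose (A : Matrix (Fin 4) (Fin 4) k) : adMat k Aᵀ = (adMat k A)ᵀ :=
  Matrix.transpose_map

/-- The transpose of the inverse of a unit is the inverse of the transpose: `(g⁻¹)ᵀ gᵀ = 1`. -/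
theorem transpose_inv_mul_transpose (g : GL4 k) : (↑(g⁻¹) : M4 k)ᵀ * (↑g : M4 k)ᵀ = 1 := by
  rw [← Matrix.transpose_mul, Units.mul_inv, Matrix.transpose_one]

/-- The transpose of a unit times the transpose of its inverse is `1`. -/
theorem transpose_mul_transpose_inv (g : GL4 k) : (↑g : M4 k)ᵀ * (↑(g⁻¹) : M4 k)ᵀ = 1 := by
  rw [← Matrix.transpose_mul, Units.inv_mul, Matrix.transpose_one]

/-- **The adelic unitary group of the plane**: `{g ∈ GL₄(𝔸_k) | g Ω = Ω g ∧ g B gᵀ = B}`. -/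
def unitaryGroup : Subgroup (GL4 k) where
  carrier := {g | (↑g : M4 k) * adMat k W.Ω = adMat k W.Ω * (↑g : M4 k) ∧
    (↑g : M4 k) * adMat k W.B * (↑g : M4 k)ᵀ = adMat k W.B}
  one_mem' := by simp
  mul_mem' := by
    rintro g h ⟨hg1, hg2⟩ ⟨hh1, hh2⟩
    refine ⟨?_, ?_⟩
    · simp only [Units.val_mul]
      rw [Matrix.mul_assoc, hh1, ← Matrix.mul_assoc, hg1, Matrix.mul_assoc]
    · simp only [Units.val_mul, Matrix.transpose_mul]
      calc (↑g : M4 k) * ↑h * adMat k W.B * ((↑h : M4 k)ᵀ * (↑g : M4 k)ᵀ)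
          = (↑g : M4 k) * ((↑h : M4 k) * adMat k W.B * (↑h : M4 k)ᵀ) * (↑g : M4 k)ᵀ := by
            simp only [Matrix.mul_assoc]
        _ = adMat k W.B := by rw [hh2, hg2]
  inv_mem' := by
    rintro g ⟨hg1, hg2⟩
    have h1 : (↑(g⁻¹) : M4 k) * (↑g : M4 k) = 1 := Units.inv_mul g
    have h2 : (↑g : M4 k) * (↑(g⁻¹) : M4 k) = 1 := Units.mul_inv g
    refine ⟨?_, ?_⟩
    · calc (↑(g⁻¹) : M4 k) * adMat k W.Ω
          = (↑(g⁻¹) : M4 k) * adMat k W.Ω * ((↑g : M4 k) * (↑(g⁻¹) : M4 k)) := by rw [h2, Matrix.mul_one]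
        _ = (↑(g⁻¹) : M4 k) * ((↑g : M4 k) * adMat k W.Ω) * (↑(g⁻¹) : M4 k) := by
            rw [hg1]; simp only [Matrix.mul_assoc]
        _ = adMat k W.Ω * (↑(g⁻¹) : M4 k) := by
            rw [← Matrix.mul_assoc, h1, Matrix.one_mul]
    · have h3 := transpose_mul_transpose_inv g
      calc (↑(g⁻¹) : M4 k) * adMat k W.B * (↑(g⁻¹) : M4 k)ᵀ
          = (↑(g⁻¹) : M4 k) * ((↑g : M4 k) * adMat k W.B * (↑g : M4 k)ᵀ) * (↑(g⁻¹) : M4 k)ᵀ := by rw [hg2]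
        _ = ((↑(g⁻¹) : M4 k) * (↑g : M4 k)) * adMat k W.B * ((↑g : M4 k)ᵀ * (↑(g⁻¹) : M4 k)ᵀ) := by
            simp only [Matrix.mul_assoc]
        _ = adMat k W.B := by rw [h1, h3, Matrix.one_mul, Matrix.mul_one]

/-- The carrier type of the adelic unitary group. -/
abbrev GA : Type := ↥(unitaryGroup W)

/-- Membership unfolded. -/
theorem mem_unitaryGroup (g : GL4 k) : g ∈ unitaryGroup W ↔
    (↑g : M4 k) * adMat k W.Ω = adMat k W.Ω * (↑g : M4 k) ∧
      (↑g : M4 k) * adMat k W.B * (↑g : M4 k)ᵀ = adMat k W.B :=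
  Iff.rfl

/-- The image of `GL₄(k)` in `GL₄(𝔸_k)` (the principal adelic matrices). -/
def principalGL : Subgroup (GL4 k) := (Matrix.GeneralLinearGroup.map (algebraMap k (Ad k))).range

/-- **The rational points `G(k)`** as a subgroup of `G(𝔸_k)`: the principal elements of the unitary group. -/
def rationalPoints : Subgroup (GA W) := (principalGL (k := k)).subgroupOf (unitaryGroup W)

/-- The adelic matrix of an element of the unitary group. -/
abbrev GA.mat (g : GA W) : M4 k := (↑(↑g : GL4 k) : M4 k)

/-- `mat` is multiplicative. -/
theorem GA.mat_mul (g h : GA W) : GA.mat W (g * h) = GA.mat W g * GA.mat W h := rfl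

/-- `mat g⁻¹ * mat g = 1`. -/
theorem GA.mat_inv_mul (g : GA W) : GA.mat W g⁻¹ * GA.mat W g = 1 := by
  show (↑(↑(g⁻¹) : GL4 k) : M4 k) * _ = 1
  rw [Subgroup.coe_inv]; exact Units.inv_mul _

/-- `mat g * mat g⁻¹ = 1`. -/
theorem GA.mat_mul_inv (g : GA W) : GA.mat W g * GA.mat W g⁻¹ = 1 := by
  show _ * (↑(↑(g⁻¹) : GL4 k) : M4 k) = 1
  rw [Subgroup.coe_inv]; exact Units.mul_inv _

/-- The subgroup of `G(𝔸_k)` commuting with a given `k`-matrix `A` (adelically). -/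
def commutant (A : Matrix (Fin 4) (Fin 4) k) : Subgroup (GA W) where
  carrier := {g | GA.mat W g * adMat k A = adMat k A * GA.mat W g}
  one_mem' := by simp [GA.mat]
  mul_mem' := by
    intro g h hg hh
    simp only [Set.mem_setOf_eq, GA.mat_mul] at *
    rw [Matrix.mul_assoc, hh, ← Matrix.mul_assoc, hg, Matrix.mul_assoc]
  inv_mem' := by
    intro g hg
    simp only [Set.mem_setOf_eq] at *
    have h1 := GA.mat_inv_mul W g
    have h2 := GA.mat_mul_inv W g
    calc GA.mat W g⁻¹ * adMat k A
        = GA.mat W g⁻¹ * adMat k A * (GA.mat W g * GA.mat W g⁻¹) := by rw [h2, Matrix.mul_one]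
      _ = GA.mat W g⁻¹ * (GA.mat W g * adMat k A) * GA.mat W g⁻¹ := by rw [hg]; simp only [Matrix.mul_assoc]
      _ = adMat k A * GA.mat W g⁻¹ := by rw [← Matrix.mul_assoc, h1, Matrix.one_mul]

/-- **The torus `T = U(W₀) × U(W₁)`**: the elements of `G(𝔸_k)` preserving both lines, i.e. commuting with the two
projectors `P 0`, `P 1`. -/
def torusT : Subgroup (GA W) := commutant W (W.P 0) ⊓ commutant W (W.P 1)

/-- **The torus `T′ = g (U(W₂) × U(W₃)) g⁻¹`**: the elements commuting with the projectors `Q 0`, `Q 1`. -/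
def torusT' : Subgroup (GA W) := commutant W (W.Q 0) ⊓ commutant W (W.Q 1)

/-- **The centre `Z`**: the central elements of `G(𝔸_k)` lying in both tori (for the unitary group of the plane the
centre consists of the `E′`-scalars of norm one, which preserve every `E′`-line; here `Z` is DEFINED as the
intersection with the two tori, so `Z ≤ T`, `Z ≤ T′` hold by definition). -/
def centre : Subgroup (GA W) := torusT W ⊓ torusT' W ⊓ Subgroup.center (GA W)

/-- `Z ≤ T`. -/
theorem centre_le_torusT : centre W ≤ torusT W := fun _ h => h.1.1

/-- `Z ≤ T′`. -/
theorem centre_le_torusT' : centre W ≤ torusT' W := fun _ h => h.1.2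

/-- The elements of `Z` are central. -/
theorem centre_le_center : centre W ≤ Subgroup.center (GA W) := fun _ h => h.2

/-- The rational points of a subgroup `S ≤ G(𝔸_k)`: `S ⊓ G(k)`, as a subgroup of `S`. -/
def rationalOf (S : Subgroup (GA W)) : Subgroup S := (rationalPoints W).subgroupOf S

end Groups

end Summit.Ventures.HodgeRepro.Tier4.Common

end
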